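import Summits.ResolutionOfSingularities.ResolutionOfSingularities.Theorems.UniversalCellsMatroidCellResChartEquivalence
import Summits.ResolutionOfSingularities.ResolutionOfSingularities.Theorems.UniversalCellsMatroidCellResChartReductionNamed
import Summits.ResolutionOfSingularities.ResolutionOfSingularities.Theorems.UniversalCellsMatroidCellResStubRegularPointLocalRes
import HarnessLib

/-!
# `MatroidCellRes` ⇔ local resolution at the SINGULAR CLOSED POINTS of saturated charts

Support file for crux item `stmt-ResolutionOfSingularities-15230` (line `birth`, lead prover c3).

`UniversalCellsMatroidCellResChartEquivalence.lean` proved the crux `UniversalCells.MatroidCellRes`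
equivalent to pointwise-local resolvability of the saturated integral principal affine charts
`Spec (Q_Γ)_g` of Γ-schemes over `𝔽_p`. Here the points at which anything has to be done are cut
down to the SINGULAR CLOSED points of charts of dimension `≥ 2`
(`matroidCellRes_iff_singularClosedPointEngine`):

* charts of dimension `≤ 1` are resolved outright by normalisation
  (`hasResolution_away_of_dim_le_one`);
* `Spec (Q_Γ)_g` is a Jacobson space (`(Q_Γ)_g` is a Jacobson ring: a localisation of a quotient of
  a polynomial ring over the field `𝔽_p`), so every point `w` specialises to a closed point `w₀`, and
  any open neighbourhood of `w₀` contains `w` (`locallyResolvable_of_closedPoints`);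
* a closed point with regular local ring has a resolvable (indeed regular) open neighbourhood — the
  landed stub `stub_regularPointLocalRes` (open regular locus of a finite-type `𝔽_p`-scheme),
  applied to the chart, which is open-immersed in `Z_Γ` by localisation.

With Hu's claim BY NAME for the charts of INTEGRAL Γ-schemes (`hasResolution_away_of_hu2025`) the
residue of the crux becomes (`matroidCellRes_of_hu2025_of_singularClosedPointResidue`):

  for `p` prime, `Q_Γ` NOT a domain, `(Q_Γ)_g` a domain on which `Γ` is saturated, of dimension `≥ 2`,
  every SINGULAR CLOSED point of `Spec (Q_Γ)_g` has an open neighbourhood admitting a resolution —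

i.e. LOCAL resolution of singularities, near each singular closed point, of the thin cells of
non-integral Γ-schemes: the registered residue stub (N) of `Lines/birth.lean` in its sharpest
honest (pointwise, closed, singular) form (RESHAPE 4e). No new definitions.
-/

noncomputable section

-- single-problem summit: the doubled namespace component `ResolutionOfSingularities` is forced
set_option linter.dupNamespace false

open CategoryTheory AlgebraicGeometry TopologicalSpace Literature.AlgebraicGeometry.Resolution
open Summit.ResolutionOfSingularities.ResolutionOfSingularities.Theses.UniversalCells (MatroidCellRes)
open Summit.ResolutionOfSingularities.ResolutionOfSingularities.Theorems.UniversalCells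
  (tautMatrix minorIdeal StratumRing)

namespace Summit.ResolutionOfSingularities.ResolutionOfSingularities.Theorems.MatroidCellRes

/-! ## Two general reductions -/

/-- **Closed points suffice** in a Jacobson space: if every CLOSED point of a scheme `X` whose
underlying space is Jacobson has an open neighbourhood admitting a resolution, so does every point
(a point `x` specialises to a closed point `x₀ ∈ closure {x}`, and every open neighbourhood of `x₀`
contains `x`). [folklore] -/
theorem locallyResolvable_of_closedPoints {X : Scheme.{0}} [JacobsonSpace X]
    (h : ∀ x : X, IsClosed ({x} : Set X) →
      ∃ W' : X.Opens, x ∈ W' ∧ Scheme.HasResolution (W' : Scheme.{0}))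
    (x : X) : ∃ W' : X.Opens, x ∈ W' ∧ Scheme.HasResolution (W' : Scheme.{0}) := by
  obtain ⟨x₀, hx₀, hx₀c⟩ := nonempty_inter_closedPoints (Z := closure ({x} : Set X))
    ⟨x, subset_closure rfl⟩ isClosed_closure.isLocallyClosed
  obtain ⟨W', hW', hres⟩ := h x₀ hx₀c
  obtain ⟨y, hyW, hyx⟩ := mem_closure_iff.mp hx₀ (W' : Set X) W'.isOpen hW'
  rw [Set.mem_singleton_iff] at hyx
  exact ⟨W', hyx ▸ hyW, hres⟩

/-- The spectrum of a principal localisation of a quotient of `𝔽_p[a_ij : 3 × m]` is a Jacobson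
space (the ring is Jacobson: polynomial ring over a field, quotient, localisation away from an
element). [folklore] -/
theorem jacobsonSpace_Spec_away (p : ℕ) [Fact p.Prime] (m : ℕ)
    (I : Ideal (MvPolynomial (Fin 3 × Fin m) (ZMod p)))
    (g : MvPolynomial (Fin 3 × Fin m) (ZMod p) ⧸ I) :
    JacobsonSpace (Spec (.of (Localization.Away g))) := by
  haveI : IsJacobsonRing (Localization.Away g) := isJacobsonRing_localization g
  infer_instance

/-! ## The singular-closed-point engine -/

/-- **`MatroidCellRes` from the SINGULAR-CLOSED-POINT ENGINE** (PROVED, unconditional): if on every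
saturated integral principal affine chart `Spec (Q_Γ)_g` of a Γ-scheme over `𝔽_p` of dimension
`≥ 2` (`(Q_Γ)_g` a domain, `u ∉ Γ ⇒ x_u ≠ 0 in (Q_Γ)_g`, `¬ dim ≤ 1`) every SINGULAR CLOSED point has
an open neighbourhood admitting a resolution, then `MatroidCellRes` holds:
`matroidCellRes_of_chartLocallyResolvable`, charts of dimension `≤ 1` resolved by normalisation,
reduction to closed points (`locallyResolvable_of_closedPoints`), regular closed points by the
landed stub `stub_regularPointLocalRes`. [folklore] -/
theorem matroidCellRes_of_singularClosedPointEngine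
    (hE : ∀ p : ℕ, p.Prime → ∀ (m : ℕ) (Γ : Set (Fin 3 → Fin 3 ⊕ Fin m))
      (g : MvPolynomial (Fin 3 × Fin m) (ZMod p) ⧸ minorIdeal p m Γ),
      IsDomain (Localization.Away g) →
        (∀ u : Fin 3 → Fin 3 ⊕ Fin m, u ∉ Γ →
          algebraMap (MvPolynomial (Fin 3 × Fin m) (ZMod p) ⧸ minorIdeal p m Γ)
            (Localization.Away g)
            (Ideal.Quotient.mk (minorIdeal p m Γ) ((tautMatrix p m).submatrix id u).det) ≠ 0) →
        ¬ topologicalKrullDim (Spec (.of (Localization.Away g))) ≤ 1 →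
          ∀ w : Spec (.of (Localization.Away g)),
            IsClosed ({w} : Set (Spec (.of (Localization.Away g)))) →
              ¬ IsRegularLocalRing ((Spec (.of (Localization.Away g))).presheaf.stalk w) →
                ∃ W' : (Spec (.of (Localization.Away g))).Opens,
                  w ∈ W' ∧ Scheme.HasResolution (W' : Scheme.{0})) :
    MatroidCellRes := by
  refine matroidCellRes_of_chartLocallyResolvable fun p hp m Γ g hdom hsat => ?_
  haveI : Fact p.Prime := ⟨hp⟩
  by_cases hdim1 : topologicalKrullDim (Spec (.of (Localization.Away g))) ≤ 1
  · intro w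
    exact ⟨⊤, Opens.mem_top w,
      (hasResolution_away_of_dim_le_one p m (minorIdeal p m Γ) g hdom hdim1).restrict ⊤⟩
  haveI : JacobsonSpace (Spec (.of (Localization.Away g))) :=
    jacobsonSpace_Spec_away p m (minorIdeal p m Γ) g
  refine locallyResolvable_of_closedPoints fun w hw => ?_
  by_cases hreg : IsRegularLocalRing ((Spec (.of (Localization.Away g))).presheaf.stalk w)
  · exact stub_regularPointLocalRes p hp m Γ (Spec (.of (Localization.Away g)))
      (Spec.map (CommRingCat.ofHom (algebraMap _ (Localization.Away g))))
      (IsOpenImmersion.of_isLocalization g) w hreg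
  · exact hE p hp m Γ g hdom hsat hdim1 w hw hreg

/-- **`MatroidCellRes` ⇔ the singular-closed-point engine.** The crux is EQUIVALENT to: on every
saturated integral principal affine chart `Spec (Q_Γ)_g` of a Γ-scheme over `𝔽_p` of dimension
`≥ 2`, every singular closed point has an open neighbourhood admitting a resolution of
singularities (`⇒` by `chartLocallyResolvable_of_matroidCellRes`, forgetting the extra hypotheses;
`⇐` is `matroidCellRes_of_singularClosedPointEngine`). [folklore] -/
theorem matroidCellRes_iff_singularClosedPointEngine :
    MatroidCellRes ↔
      ∀ p : ℕ, p.Prime → ∀ (m : ℕ) (Γ : Set (Fin 3 → Fin 3 ⊕ Fin m))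
        (g : MvPolynomial (Fin 3 × Fin m) (ZMod p) ⧸ minorIdeal p m Γ),
        IsDomain (Localization.Away g) →
          (∀ u : Fin 3 → Fin 3 ⊕ Fin m, u ∉ Γ →
            algebraMap (MvPolynomial (Fin 3 × Fin m) (ZMod p) ⧸ minorIdeal p m Γ)
              (Localization.Away g)
              (Ideal.Quotient.mk (minorIdeal p m Γ) ((tautMatrix p m).submatrix id u).det) ≠ 0) →
          ¬ topologicalKrullDim (Spec (.of (Localization.Away g))) ≤ 1 →
            ∀ w : Spec (.of (Localization.Away g)),
              IsClosed ({w} : Set (Spec (.of (Localization.Away g)))) →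
                ¬ IsRegularLocalRing ((Spec (.of (Localization.Away g))).presheaf.stalk w) →
                  ∃ W' : (Spec (.of (Localization.Away g))).Opens,
                    w ∈ W' ∧ Scheme.HasResolution (W' : Scheme.{0}) :=
  ⟨fun h p hp m Γ g hdom _ _ w _ _ => chartLocallyResolvable_of_matroidCellRes h p hp m Γ g hdom w,
    matroidCellRes_of_singularClosedPointEngine⟩

/-- **`MatroidCellRes` from Hu's claim BY NAME and the SINGULAR-CLOSED-POINT RESIDUE** (the
composition of line `birth`, RESHAPE 4e): on a chart of an INTEGRAL Γ-scheme Hu's Theorem 1.3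
[cite: Hu2025, Thm. 1.3 (p. 8)] resolves the whole chart (`hasResolution_away_of_hu2025`, the claim
`Hu2025IntegralGammaSchemeResolution` taken as a hypothesis); what is left is local resolution near
each singular closed point of the saturated integral charts of dimension `≥ 2` of NON-integral
Γ-schemes. CONDITIONAL on the claim; the residue is open (local resolution over `𝔽_p` up to `𝔸ʳ`).
[cite: Hu2025, Thm. 1.3 (p. 8) and Lemma 7.3 (p. 58)] -/
theorem matroidCellRes_of_hu2025_of_singularClosedPointResidue
    (hH : Hu2025IntegralGammaSchemeResolution)
    (hN : ∀ p : ℕ, p.Prime → ∀ (m : ℕ) (Γ : Set (Fin 3 → Fin 3 ⊕ Fin m)),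
      ¬ IsDomain (MvPolynomial (Fin 3 × Fin m) (ZMod p) ⧸ minorIdeal p m Γ) →
      ∀ (g : MvPolynomial (Fin 3 × Fin m) (ZMod p) ⧸ minorIdeal p m Γ),
        IsDomain (Localization.Away g) →
          (∀ u : Fin 3 → Fin 3 ⊕ Fin m, u ∉ Γ →
            algebraMap (MvPolynomial (Fin 3 × Fin m) (ZMod p) ⧸ minorIdeal p m Γ)
              (Localization.Away g)
              (Ideal.Quotient.mk (minorIdeal p m Γ) ((tautMatrix p m).submatrix id u).det) ≠ 0) →
          ¬ topologicalKrullDim (Spec (.of (Localization.Away g))) ≤ 1 →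
            ∀ w : Spec (.of (Localization.Away g)),
              IsClosed ({w} : Set (Spec (.of (Localization.Away g)))) →
                ¬ IsRegularLocalRing ((Spec (.of (Localization.Away g))).presheaf.stalk w) →
                  ∃ W' : (Spec (.of (Localization.Away g))).Opens,
                    w ∈ W' ∧ Scheme.HasResolution (W' : Scheme.{0})) :
    MatroidCellRes := by
  refine matroidCellRes_of_singularClosedPointEngine
    fun p hp m Γ g hdom hsat hdim1 w hw hreg => ?_
  haveI : Fact p.Prime := ⟨hp⟩
  by_cases hQ : IsDomain (MvPolynomial (Fin 3 × Fin m) (ZMod p) ⧸ minorIdeal p m Γ)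
  · exact ⟨⊤, Opens.mem_top w, (hasResolution_away_of_hu2025 hH p m Γ hQ g).restrict ⊤⟩
  · exact hN p hp m Γ hQ g hdom hsat hdim1 w hw hreg

/-- **The singular-closed-point engine is summit-implied** (so the promoted residue is HONEST: no
refutation of it exists short of `¬ ResolutionOfSingularities`): the summit resolves every integral
principal chart outright (`hasResolution_away_of_resolutionOfSingularities`), and a global
resolution restricts to the open neighbourhood `⊤` of any point. Together with
`matroidCellRes_iff_singularClosedPointEngine`: summit ⇒ engine ⇔ crux. [folklore] -/
theorem singularClosedPointEngine_of_resolutionOfSingularities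
    (hS : _root_.ResolutionOfSingularities) :
    ∀ p : ℕ, p.Prime → ∀ (m : ℕ) (Γ : Set (Fin 3 → Fin 3 ⊕ Fin m))
      (g : MvPolynomial (Fin 3 × Fin m) (ZMod p) ⧸ minorIdeal p m Γ),
      IsDomain (Localization.Away g) →
        (∀ u : Fin 3 → Fin 3 ⊕ Fin m, u ∉ Γ →
          algebraMap (MvPolynomial (Fin 3 × Fin m) (ZMod p) ⧸ minorIdeal p m Γ)
            (Localization.Away g)
            (Ideal.Quotient.mk (minorIdeal p m Γ) ((tautMatrix p m).submatrix id u).det) ≠ 0) →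
        ¬ topologicalKrullDim (Spec (.of (Localization.Away g))) ≤ 1 →
          ∀ w : Spec (.of (Localization.Away g)),
            IsClosed ({w} : Set (Spec (.of (Localization.Away g)))) →
              ¬ IsRegularLocalRing ((Spec (.of (Localization.Away g))).presheaf.stalk w) →
                ∃ W' : (Spec (.of (Localization.Away g))).Opens,
                  w ∈ W' ∧ Scheme.HasResolution (W' : Scheme.{0}) :=
  fun p hp m Γ g hdom _ _ w _ _ =>
    ⟨⊤, Opens.mem_top w,
      (hasResolution_away_of_resolutionOfSingularities hS p hp m (minorIdeal p m Γ) g hdom).restrict ⊤⟩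

end Summit.ResolutionOfSingularities.ResolutionOfSingularities.Theorems.MatroidCellRes

end
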